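import Mathlib

/-!
# Lead a2 (crux stmt-Parity-0870 `PolyMobiusTail`) — kernel check of the Farey-triangle sign mechanism

Companion to `PICKED.md` / `Lines/SketchIdeator6-dead.md` of lead a2. This file does NOT bear on the crux
(which is Λ-Bateman–Horn for every system, `Negative/Equivalence.polyMobiusTail_iff_lambdaBatemanHorn`);
it certifies, over Mathlib's `ArithmeticFunction.liouville`, the mechanism of ideator 6's ANCHOR card
`farey-triangle-sign-anchor` and its cheapest quantitative consequence:

* `liouville_hits_edge` : for every factorisation `e * C = n ^ 2 + 1`, at least one of
  `λ(n²+1)`, `λ((n+e)²+1)`, `λ((n+C)²+1)` is `+1` (square law + complete multiplicativity + pigeonhole);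
* `sqrt_sub_one_le_three_mul_plusCount` : `Nat.sqrt x - 1 ≤ 3 · #{n ∈ [1,x] : λ(n²+1) = +1}` for every `x`
  (the `e = 1` sub-family of hyperedges `{t, t+1, t²+t+1}`, each vertex map injective);
* `plusCount_lower_eventually` : `∀ᶠ x, √x / 6 ≤ #{n ∈ [1,x] : λ(n²+1) = +1}`.

The card's `PlusSignAbundance` (`≫ x/(log x)³`) needs in addition its stubs (E) edge count and (M) second
moment of `τ(n²+1)`; those are not attempted here. No `sorry`; standard axioms.
-/

namespace Summit.Parity.BatemanHorn.Cruxes.PolyMobiusTail.LeadA2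

open Finset Filter ArithmeticFunction

/-- `λ(m)² = 1` for `m ≠ 0`. -/
theorem liouville_mul_self {m : ℕ} (hm : m ≠ 0) : liouville m * liouville m = 1 := by
  rw [liouville_apply hm, ← pow_add]
  exact Even.neg_one_pow ⟨_, rfl⟩

/-- `λ(m) ∈ {1, -1}` for `m ≠ 0`. -/
theorem liouville_eq_one_or {m : ℕ} (hm : m ≠ 0) : liouville m = 1 ∨ liouville m = -1 := by
  rw [liouville_apply hm]
  exact neg_one_pow_eq_or ℤ _

/-- The square law of the card (`FareyTriangle.sq_law`) over `ℕ`: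
`e * C = n² + 1 ⇒ ((n+e)²+1)((n+C)²+1) = (n²+1)(2n+e+C)²`. -/
theorem sq_law_nat (n e C : ℕ) (h : e * C = n ^ 2 + 1) :
    ((n + e) ^ 2 + 1) * ((n + C) ^ 2 + 1) = (n ^ 2 + 1) * (2 * n + e + C) ^ 2 := by
  have h' : (e : ℤ) * C = (n : ℤ) ^ 2 + 1 := by exact_mod_cast h
  have : (((n : ℤ) + e) ^ 2 + 1) * (((n : ℤ) + C) ^ 2 + 1)
      = ((n : ℤ) ^ 2 + 1) * (2 * (n : ℤ) + e + C) ^ 2 := by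
    linear_combination
      ((e : ℤ) * C - ((n : ℤ) ^ 2 + 1) - (2 * (n : ℤ) + e + C) * (e + C) + (2 * (n : ℤ) + e + C) ^ 2) * h'
  exact_mod_cast this

/-- The hitting mechanism of the Farey-triangle hypergraph, kernel-checked: for every factorisation
`e * C = n² + 1`, the set `{m : λ(m²+1) = +1}` meets the hyperedge `{n, n+e, n+C}`. -/
theorem liouville_hits_edge (n e C : ℕ) (h : e * C = n ^ 2 + 1) :
    liouville (n ^ 2 + 1) = 1 ∨ liouville ((n + e) ^ 2 + 1) = 1 ∨
      liouville ((n + C) ^ 2 + 1) = 1 := by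
  have hmul := congrArg (fun m : ℕ => liouville m) (sq_law_nat n e C h)
  have he : e ≠ 0 := by
    rintro rfl
    simp at h
  have hsqv : liouville ((2 * n + e + C) ^ 2) = 1 := by
    rw [pow_two, liouville_apply_mul]
    exact liouville_mul_self (by omega)
  simp only [liouville_apply_mul, hsqv, mul_one] at hmul
  by_contra hcon
  push Not at hcon
  obtain ⟨h0, h1, h2⟩ := hcon
  have e0 := (liouville_eq_one_or (m := n ^ 2 + 1) (by positivity)).resolve_left h0
  have e1 := (liouville_eq_one_or (m := (n + e) ^ 2 + 1) (by positivity)).resolve_left h1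
  have e2 := (liouville_eq_one_or (m := (n + C) ^ 2 + 1) (by positivity)).resolve_left h2
  rw [e0, e1, e2] at hmul
  norm_num at hmul

/-- The `e = 1` sub-family: `{t, t+1, t+(t²+1)}` is a hyperedge (`f(t)·f(t+1) = f(t²+t+1)`). -/
theorem liouville_hits_edge_one (t : ℕ) :
    liouville (t ^ 2 + 1) = 1 ∨ liouville ((t + 1) ^ 2 + 1) = 1 ∨
      liouville ((t + (t ^ 2 + 1)) ^ 2 + 1) = 1 :=
  liouville_hits_edge t 1 (t ^ 2 + 1) (one_mul _)

/-- `P(x) = #{n ∈ [1, x] : λ(n² + 1) = +1}`. -/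
def plusCount (x : ℕ) : ℕ := ((Icc 1 x).filter (fun n => liouville (n ^ 2 + 1) = 1)).card

/-- The elementary abundance bound from the `e = 1` hyperedges: `Nat.sqrt x - 1 ≤ 3 · P(x)`. -/
theorem sqrt_sub_one_le_three_mul_plusCount (x : ℕ) : Nat.sqrt x - 1 ≤ 3 * plusCount x := by
  classical
  set s := Nat.sqrt x with hs
  set P := (Icc 1 x).filter (fun n => liouville (n ^ 2 + 1) = 1) with hP
  set T := Icc 1 (s - 1) with hT
  -- every t ∈ T has t + 1 ≤ s, hence t + (t²+1) ≤ (t+1)² ≤ s² ≤ x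
  have hTx : ∀ t ∈ T, 1 ≤ t ∧ t + (t ^ 2 + 1) ≤ x := by
    intro t ht
    rw [hT, mem_Icc] at ht
    have hspos : 0 < s := by omega
    have hts : t + 1 ≤ s := by omega
    have h1 : (t + 1) ^ 2 ≤ s ^ 2 := Nat.pow_le_pow_left hts 2
    have h2 : s ^ 2 ≤ x := Nat.sqrt_le' x
    refine ⟨ht.1, ?_⟩
    nlinarith
  set A1 := T.filter (fun t => liouville (t ^ 2 + 1) = 1) with hA1
  set A2 := T.filter (fun t => liouville ((t + 1) ^ 2 + 1) = 1) with hA2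
  set A3 := T.filter (fun t => liouville ((t + (t ^ 2 + 1)) ^ 2 + 1) = 1) with hA3
  have hcover : T ⊆ A1 ∪ A2 ∪ A3 := by
    intro t ht
    rcases liouville_hits_edge_one t with h | h | h
    · exact mem_union_left _ (mem_union_left _ (mem_filter.mpr ⟨ht, h⟩))
    · exact mem_union_left _ (mem_union_right _ (mem_filter.mpr ⟨ht, h⟩))
    · exact mem_union_right _ (mem_filter.mpr ⟨ht, h⟩)
  have hc1 : A1.card ≤ P.card := by
    refine Finset.card_le_card_of_injOn (fun t => t) (fun t ht => ?_) (fun a _ b _ h => h)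
    simp only [Finset.mem_coe, hA1, mem_filter] at ht
    obtain ⟨h1, h2⟩ := hTx t ht.1
    simp only [Finset.mem_coe, hP, mem_filter, mem_Icc]
    exact ⟨⟨h1, by nlinarith⟩, ht.2⟩
  have hc2 : A2.card ≤ P.card := by
    refine Finset.card_le_card_of_injOn (fun t => t + 1) (fun t ht => ?_)
      (fun a _ b _ h => by simpa using h)
    simp only [Finset.mem_coe, hA2, mem_filter] at ht
    obtain ⟨h1, h2⟩ := hTx t ht.1
    simp only [Finset.mem_coe, hP, mem_filter, mem_Icc]
    exact ⟨⟨by omega, by nlinarith⟩, ht.2⟩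
  have hc3 : A3.card ≤ P.card := by
    refine Finset.card_le_card_of_injOn (fun t => t + (t ^ 2 + 1)) (fun t ht => ?_)
      (fun a _ b _ h => ?_)
    · simp only [Finset.mem_coe, hA3, mem_filter] at ht
      obtain ⟨h1, h2⟩ := hTx t ht.1
      simp only [Finset.mem_coe, hP, mem_filter, mem_Icc]
      exact ⟨⟨by omega, h2⟩, ht.2⟩
    · simp only at h
      by_contra hne
      rcases Nat.lt_or_gt_of_ne hne with hlt | hlt <;> nlinarith
  have hT_card : T.card = s - 1 := by simp [hT]
  calc s - 1 = T.card := hT_card.symm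
    _ ≤ (A1 ∪ A2 ∪ A3).card := card_le_card hcover
    _ ≤ (A1 ∪ A2).card + A3.card := card_union_le _ _
    _ ≤ A1.card + A2.card + A3.card := by gcongr; exact card_union_le _ _
    _ ≤ P.card + P.card + P.card := by gcongr
    _ = 3 * plusCount x := by rw [plusCount, ← hP]; ring

/-- Eventual real form: `√x / 6 ≤ P(x)` for all large `x`. -/
theorem plusCount_lower_eventually :
    ∀ᶠ x : ℕ in atTop, Real.sqrt x / 6 ≤ (plusCount x : ℝ) := by
  filter_upwards [eventually_ge_atTop 16] with x hx
  have h := sqrt_sub_one_le_three_mul_plusCount x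
  -- Nat.sqrt x ≥ 4 and √x < Nat.sqrt x + 1
  have hs4 : 4 ≤ Nat.sqrt x := by
    rw [Nat.le_sqrt]; omega
  have hreal : ((Nat.sqrt x - 1 : ℕ) : ℝ) ≤ 3 * (plusCount x : ℝ) := by exact_mod_cast h
  have hsub : ((Nat.sqrt x - 1 : ℕ) : ℝ) = (Nat.sqrt x : ℝ) - 1 := by
    rw [Nat.cast_sub (by omega)]; simp
  have hsqrt : Real.sqrt x < (Nat.sqrt x : ℝ) + 1 := by
    have := Nat.lt_succ_sqrt' x   -- x < (sqrt x + 1)^2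
    rw [Real.sqrt_lt' (by positivity)]
    exact_mod_cast this
  have hs4' : (4 : ℝ) ≤ Nat.sqrt x := by exact_mod_cast hs4
  rw [hsub] at hreal
  linarith

end Summit.Parity.BatemanHorn.Cruxes.PolyMobiusTail.LeadA2
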